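import Summits.QuantumFields.YangMills.Theorems.BalabanUVNodesPortS1Functional
import Literature.MathematicalPhysics.QuantumFieldTheory.Balaban1983to89.Node00.ShearedAveragingRecordPureGauge
import Literature.MathematicalPhysics.QuantumFieldTheory.Balaban1983to89.B12Form13Step268

/-!
# BalabanUVNodes — port (S1), FE-1 normalisation row (N-0), BASE OF THE SCALE: at `k = 0` the merged term of record VANISHES at the unit datum — `recordΦfAx F a₀ ε₂₉ 0 v K 0 = 0` — UNCONDITIONALLY
  (`0 < a₀`): `A_1(1) = 0` (lit ✓`nextAction_one`) and `A_0(U_1-choice(1)) = −(1∕g_0²)·A^η(U_1-choice(1)) = 0` because the chosen configuration MINIMISES the non-negative Wilson action over a class containing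
  `1` (or is the junk default `1`) (porter hand `hand-27930-FE-1` g0, cell `ym-nodeO-ideate`; ★★★ director-ym g24 №615 (2) «row (N-0) … k = 0 Wilson unconditional»)

`--supports stmt-QuantumFields-27930` (helper; NO `--workitem`); count-neutral.  [I] = [Balaban1987RG1].

WHY.  ✓`FEChartLawStep` (FE-1) asserts `phiFE … B = feFluctDiff … B` eventually at `0`; since `feFluctDiff … 0 = 0` and `phiLZ … 0 = 0`, it PRESUPPOSES print's normalisation `recordΦfAx … 0 = 𝓝_{k+1}(W_0) = 0`
((2.12) «𝐍_k = the integral at U_{k+1} = 1» + (2.14)) — row (N-0) of the director's book (№615 (2)).  For `k ≥ 1` it needs the regularity of the pure-gauge images of `1` (`TcanOfRecord` is invariant only on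
`regSetOfRecord`; ▶ PT-A-1 answers whether the ⁸ antecedent gives it).  THIS FILE proves the `k = 0` instance, which needs nothing: ★ `wilsonAction4_Uk_one_eq_zero` (the chosen minimiser over `W = 1`
has Wilson action `0`: `1` is admissible — ✓`one_mem_bgReg`, ✓`avOfRecord_avg_one`∕✓`iter_one` — and `A ≥ 0`, ✓`wilsonAction4_nonneg`; off the solvable set `Uk = 1`, ✓`wilsonAction_one`),
★ `mergedTermT_zero_scale_one` (`𝓝_1(g; 1) = 0` for every transport, cut-off family and positive radius), ★★ `recordΦfAx_zero_scale_at_zero` (`recordΦfAx F a₀ ε₂₉ 0 v K 0 = 0` for `0 < a₀`, through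
✓`recordΦfAx_eq_mergedTermT_unitField` + ✓`unitField_zero`).  DEDUP: 3 new names, 0 tree hits.

HONEST STATUS.  Elementary (minimality of a chosen minimiser + `log(x⁻¹x) = 0`); the `k ≥ 1` row (N-0) is NOT proved and NOT claimed; NOTHING of Bałaban's (2.10)–(2.14) asserted, ported or discharged;
`stub_FEstep` ∕ `stub_P0C` OPEN; ⟨27930⟩ OPEN (1∕3); NODE O 0∕1; COUNT 8∕28 · K 1∕4 UNMOVED; finite 𝕋⁴_{L^K} at fixed ε — NOT continuum ∕ OS ∕ Clay; **the Yang–Mills mass gap (Clay) is NOT proved by any of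
this.**  No `sorry`; standard axioms.

References: T. Bałaban, *Renormalization group approach to lattice gauge field theories. I*, Comm. Math. Phys. 109 (1987) 249–301 [Balaban1987RG1] — (0.17)–(0.19) p.255, (0.21) p.256, (1.6) p.261,
(2.12)∕(2.14) p.268; [Balaban1985Variational] Thm 1 p.279.
-/

noncomputable section

namespace Summit.QuantumFields.YangMills.Theorems.BalabanUVNodesPortS1

open Summit.QuantumFields.YangMills.Theorems.K0RecordFormatNames
open Literature.MathematicalPhysics.QuantumFieldTheory.Balaban1983to89
open Literature.MathematicalPhysics.QuantumFieldTheory.Balaban1983to89.Node00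
open Literature.MathematicalPhysics.QuantumFieldTheory.Balaban1983to89.T4Continuum (T4Family)

variable (F : T4Family)

/-- ★ **The chosen minimiser over the unit field has Wilson action `0`** (`0 < ε`): on the solvable set `U_k-choice(1)` minimises `A ≥ 0` over a class containing `1` (`A(1) = 0`); off it the junk default
is `1`. [cite: Balaban1987RG1, (0.21) p.256; Balaban1985Variational, Thm 1 p.279] -/
theorem wilsonAction4_Uk_one_eq_zero (K k : ℕ) {ε : ℝ} (hε : 0 < ε) :
    wilsonAction4 (Uk F 2 K k ε (1 : GaugeField (F.P K) k (SU 2))) = 0 := by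
  by_cases h : UkExists F 2 K k ε (1 : GaugeField (F.P K) k (SU 2))
  · have hB := isBackground_Uk h
    have hmin := hB.2.2 1 (one_mem_bgReg (F := F) (N := 2) K k hε)
      (iter_one (avOfRecord F 2 K) (fun i => avOfRecord_avg_one (F := F) (N := 2) K i) k)
    have h1 : wilsonAction4 (1 : GaugeField (F.P K) 0 (SU 2)) = 0 := B12Form13Step268.wilsonAction_one 1
    exact le_antisymm (h1 ▸ hmin) (wilsonAction4_nonneg _)
  · rw [Uk_of_not h]
    exact B12Form13Step268.wilsonAction_one 1

/-- ★ **`𝓝_1(g; 1) = 0`** — the merged term at the BASE scale vanishes at the unit coarse field, for every transport, cut-off family, history and positive regularity radius: `A_1(1) = 0` (lit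
✓`nextAction_one`, unconditional) and `A_0(Ū^0(U_1-choice(1))) = −(1∕g_0²)·A(U_1-choice(1)) = 0`. [cite: Balaban1987RG1, (1.6) p.261, (0.17)–(0.19) p.255, (2.14) p.268] -/
theorem mergedTermT_zero_scale_one (T : Transport F 2) (χ : (K : ℕ) → (ℕ → ℝ) → (k : ℕ) → Density (F.P K) k (SU 2)) {ε : ℝ} (hε : 0 < ε) (K : ℕ) (g : ℕ → ℝ) :
    mergedTermT F 2 T χ ε K g 0 (1 : GaugeField (F.P K) 1 (SU 2)) = 0 := by
  unfold mergedTermT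
  rw [effActionHT_succ, B12Eq019ActionBody.nextAction_one, effActionHT_zero, B12Eq019ActionBody.wilsonTerm_apply]
  show (0 : ℝ) - -(1 / g 0 ^ 2) * wilsonAction 1 (Uk F 2 K 1 ε (1 : GaugeField (F.P K) 1 (SU 2))) = 0
  have h := wilsonAction4_Uk_one_eq_zero F K 1 hε
  unfold wilsonAction4 at h
  rw [h, mul_zero, sub_zero]

/-- ★★ **ROW (N-0) AT THE BASE SCALE: `recordΦfAx F a₀ ε₂₉ 0 v K 0 = 0`** (`0 < a₀`) — the record's merged term at `k = 0` vanishes at the unit datum `B = 0` (`W_0 = 1`, ✓`unitField_zero`), print's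
normalisation (2.12)∕(2.14), UNCONDITIONALLY.  (The `k ≥ 1` row needs the regularity of the pure-gauge images of `1`; not claimed here.) [cite: Balaban1987RG1, (2.12)∕(2.14) p.268, (1.6) p.261] -/
theorem recordΦfAx_zero_scale_at_zero (a₀ ε₂₉ : ℝ) (ha₀ : 0 < a₀) (v : Fin (0 + 1) → ℝ) (K : ℕ) :
    letI θ := thetaFill F a₀ ε₂₉
    letI := θ.instVβ₁; letI := θ.instVβ₂
    recordΦfAx F a₀ ε₂₉ 0 v K 0 = 0 := by
  letI := (thetaFill F a₀ ε₂₉).instVβ₁; letI := (thetaFill F a₀ ε₂₉).instVβ₂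
  have hε : 0 < (thetaFill F a₀ ε₂₉).εbg := ha₀
  have h1 := unitField_zero F (thetaFill F a₀ ε₂₉) 0 K
  rw [recordΦfAx_eq_mergedTermT_unitField]
  show ((mergedTermT F 2 (TβOfRecord₁₃ F 2) (chiβOfRecord₁₃Ax F 2 (thetaFill F a₀ ε₂₉)) (thetaFill F a₀ ε₂₉).εbg K (T4FlagMemory.extd v) 0
      (unitField F (thetaFill F a₀ ε₂₉) 0 K 0) : ℝ) : ℂ) = 0
  rw [h1, mergedTermT_zero_scale_one F _ _ hε, Complex.ofReal_zero]

-- standard axioms only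
#print axioms recordΦfAx_zero_scale_at_zero

end Summit.QuantumFields.YangMills.Theorems.BalabanUVNodesPortS1

end
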